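import Literature.NumberTheory.EllipticCurves.Kato2004.LocalIwasawaCohomologyPoitouTateProofs
import Literature.NumberTheory.EllipticCurves.Kato2004.IwasawaH1LambdaTorsionFreeProofs
import Literature.NumberTheory.EllipticCurves.Kato2004.IwasawaH1RankLeOneProofs
import Literature.NumberTheory.EllipticCurves.IwasawaAlgebraStructureProofs
import HarnessLib

/-!
# The `μ`-invariant of the ZETA QUOTIENT `𝐇¹_Γ(T_pW) ⧸ Λ𝐳` and `μ`-free values of ordinary-kernel functionals — proofs only
# (every prime `p`; algebra over `Λ = ℤ_p⟦X⟧` + the Poitou–Tate exactness fact p729889)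

Sibling proof file (D-0014: theorems only, no definition, no named fact, no `sorry`, no instance) of
`LocalIwasawaCohomologyPoitouTateProofs.lean` (width seat `cruxlead-stmt-BirchSwinnertonDyer-19573-w3` g6). Topic
`NumberTheory/EllipticCurves/Kato2004` (namespace = path). Written by the same width lineage (g7, cell `pub/bsd-2adic`) for the line
`steinberg-fibre-at-two` of crux `OrdKatoHalfAtTwoIso` (`Summits/BirchSwinnertonDyer`, item 19573, child 24097), but NOTHING here is
specific to any summit: every statement is about the tree's Literature objects (`IwasawaH1Data`, `LocalIwasawaH1Data`, `SelmerDualData`)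
at an arbitrary prime `p`, or is pure module algebra over `Λ`. HONEST FRAMING: CONDITIONAL on the named fact where it appears as a hypothesis;
BSD is not proved by any of this.

## What is proved (the kernel of the identity `μ(L_p) = μ(coarse) + μ(𝐇¹/Z)` of [Kato2004Asterisque, §17.13 (p. 280)])
Kato's §17.13 computes, from the Poitou–Tate sequence (17.13.1) and Prop. 17.11, for `p ≠ 2` under (12.5.2):
`length_𝔭(X) − length_𝔭(Λ/(L_p)) = length_𝔭(𝐇²) − length_𝔭(𝐇¹(T)/Z(f,T))` at every height-one `𝔭`, in particular at `𝔭 = (p)`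
(the `μ`-parts). This file proves the two ALGEBRAIC implications behind the `𝔭 = (p)` bookkeeping that need neither Coleman maps nor
`p`-adic `L`-functions nor `p ≠ 2`, for an ARBITRARY class `z ∈ 𝐇¹_Γ(T_pW)` in place of Kato's `Z(f,T)`:
* §1 (algebra, no facts). `map_le_augIdealP_of_moduleFinite_quotient`: a `Λ`-linear functional `φ : M → Λ` which sends a submodule `N` into
  `(p)` sends all of `M` into `(p)` as soon as `M ⧸ N` is finitely generated over `ℤ_p` (`μ(M/N) = 0` for torsion quotients) — the g6 KEY LEMMA
  `mem_augIdealP_of_addMonoidHom_of_moduleFinite` applied to `M ↠ M ⧸ N`; the cyclic case `notMem_augIdealP_of_moduleFinite_quotient_span`: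
  «`μ(M/Λz) = 0` and `φ(y) ∉ (p)` for SOME `y` force `φ(z) ∉ (p)`». Conversely `moduleFinite_quotient_span_of_notMem_augIdealP`: over the
  torsion-free `Λ`-module `M` of rank `≤ 1`, `φ(z) ∉ (p)` forces `M ⧸ Λz` finitely generated over `ℤ_p` (`φ` is then injective —
  `injective_of_rank_le_one_of_apply_ne_zero` — and `M ⧸ Λz ↪ Λ ⧸ (φ z)`, finitely generated over `ℤ_p` by Weierstrass preparation,
  `moduleFinite_quotient_span_singleton_of_notMem_augIdealP`).
* §2 (on Kato's carriers, every `p`). `notMem_col_loc_of_poitouTate_of_moduleFinite_quotient_span`: the Poitou–Tate exactness fact p729889 +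
  `X(E/ℚ_∞)` finitely generated over `ℤ_p` (`μ(X) = 0` for torsion `X`: Greenberg's Conjecture 1.11 — a HYPOTHESIS) + a class `z ∈ 𝐇¹_Γ` with
  `𝐇¹_Γ ⧸ Λz` finitely generated over `ℤ_p` (`μ(𝐇¹/Λz) = 0` — a HYPOTHESIS; for `z` Kato's zeta class this is the `μ`-part of the term
  `𝐇¹(T)/Z(f,T)` of §17.13) ⟹ EVERY normalised ordinary-kernel functional `col` has `col(loc_v z) ∉ (p)` (g6's
  `exists_notMem_col_loc_of_poitouTate_of_moduleFinite` gives SOME global class with a `μ`-free value; §1 moves it to `z`). Conversely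
  `moduleFinite_iwasawaH1_quotient_span_of_notMem_col_loc`: `col(loc_v z) ∉ (p)` for ONE such `col` + `rank_Λ 𝐇¹_Γ ≤ 1` (Kato Thm. 12.4 (2),
  displayed as the hypothesis `hrk`; torsion-freeness is the tree theorem `IwasawaH1Data.isTorsionFree`) ⟹ `𝐇¹_Γ ⧸ Λz` finitely generated over `ℤ_p`.
So, modulo p729889 and Kato 12.4 (2): «`μ(X) = 0` ∧ `μ(𝐇¹_Γ/Λz) = 0`» ⟹ «`col(loc_v z)` is `μ`-free for every normalised `col`» ⟹ «`μ(𝐇¹_Γ/Λz) = 0`».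
* §3 (appended, g7). `not_moduleFinite_quotient_span_of_mem_augIdealP_smul_top`: in a non-zero torsion-free `Λ`-module, `z ∈ (p)·M` forces
  `M ⧸ Λz` NOT finitely generated over `ℤ_p` (an `X`-monic relation on `w̄`, `z = p•w`, would put the monic in `(p)`); on the carriers
  `IwasawaH1Data.not_mem_augIdealP_smul_top_of_moduleFinite_quotient_span[_of_thm12_4]`: `μ(𝐇¹_Γ/Λz) = 0` ⟹ `z ∉ (p)·𝐇¹_Γ` once `𝐇¹_Γ ≠ 0`
  (Kato 12.4 (2)) — the currency of the Summits-side Negative lemma p691215 («every genuine class `2`-divisible»).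
At `p = 2` the Summits side reads this with `z` a GENUINE Euler-system class (`IsEulerSystemClassTwo`), splitting the line's memo stub V♭⁻.

References: [Kato2004Asterisque] Thm. 12.4 (2) (p. 221), Prop. 17.11 (p. 277), §17.13 (17.13.1)–(17.13.3) (pp. 279–280); [GreenbergLNM1716] Conj. 1.11
(p. 64), §4 p. 122; [Washington1997] §7.1 Thm. 7.3 (Weierstrass preparation), §13.2. Tree: `LocalIwasawaCohomologyPoitouTateProofs.lean` (g6),
`IwasawaAlgebraStructureProofs.lean` (`exists_eq_C_pow_mul_and_map_residue_ne_zero`), `IwasawaAlgebra.lean` (`finite_quotient_pow`),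
`IwasawaH1LambdaTorsionFreeProofs.lean` (`IwasawaH1Data.isTorsionFree`), `IwasawaH1RankLeOneProofs.lean`.
-/

set_option autoImplicit false

noncomputable section

open scoped Classical NumberField
open Field IsDedekindDomain WeierstrassCurve
open Literature.NumberTheory.GaloisRepresentations
open Literature.NumberTheory.EllipticCurves Literature.NumberTheory.EllipticCurves.GreenbergSelmer
open Literature.NumberTheory.EllipticCurves.Kato2004.EulerSystemValues

namespace Literature.NumberTheory.EllipticCurves.Kato2004

/-! ## §1 Algebra over `Λ = ℤ_p⟦X⟧` -/

section Algebra

variable {p : ℕ} [Fact p.Prime]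

/-- **A `Λ`-linear functional sending `N` into `(p)` sends `M` into `(p)` when `M ⧸ N` is finitely generated over `ℤ_p`** (for torsion
`M ⧸ N`: `μ(M/N) = 0`): the quotient map `M ↠ M ⧸ N` commutes with the constants, so the g6 KEY LEMMA
`mem_augIdealP_of_addMonoidHom_of_moduleFinite` applies (`X`-monic `g ∉ (p)` with `g • x ∈ N`, `g · φ x ∈ (p)`, `(p)` prime).
[cite: Washington1997, §13.2] [cite: Kato2004Asterisque, §17.13 (p. 280) (the `μ`-bookkeeping, shape)] -/
theorem map_le_augIdealP_of_moduleFinite_quotient {M : Type*} [AddCommGroup M] [Module (IwasawaAlgebra p) M]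
    (N : Submodule (IwasawaAlgebra p) M)
    (hfin : Module.Finite ℤ_[p] (RestrictScalars ℤ_[p] (IwasawaAlgebra p) (M ⧸ N)))
    (φ : M →ₗ[IwasawaAlgebra p] IwasawaAlgebra p) (hN : ∀ x ∈ N, φ x ∈ IwasawaAlgebra.augIdealP p) (x : M) :
    φ x ∈ IwasawaAlgebra.augIdealP p :=
  mem_augIdealP_of_addMonoidHom_of_moduleFinite hfin N.mkQ.toAddMonoidHom
    (fun c y => by
      change N.mkQ (PowerSeries.C c • y) = PowerSeries.C c • N.mkQ y
      rw [map_smul])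
    φ (fun y hy => hN y ((Submodule.Quotient.mk_eq_zero N).mp hy)) x

/-- **Cyclic case: `μ(M ⧸ Λz) = 0` moves a `μ`-free value to `z`.**  If `M ⧸ Λz` is finitely generated over `ℤ_p` and a `Λ`-linear
`φ : M → Λ` takes SOME value outside `(p)`, then `φ z ∉ (p)` (else `φ(Λz) ⊆ (p)`, hence `φ(M) ⊆ (p)` by the previous lemma).
[cite: Washington1997, §13.2] [cite: Kato2004Asterisque, §17.13 (p. 280) (shape)] -/
theorem notMem_augIdealP_of_moduleFinite_quotient_span {M : Type*} [AddCommGroup M] [Module (IwasawaAlgebra p) M]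
    (z : M) (hfin : Module.Finite ℤ_[p] (RestrictScalars ℤ_[p] (IwasawaAlgebra p) (M ⧸ (IwasawaAlgebra p) ∙ z)))
    (φ : M →ₗ[IwasawaAlgebra p] IwasawaAlgebra p) {y : M} (hy : φ y ∉ IwasawaAlgebra.augIdealP p) :
    φ z ∉ IwasawaAlgebra.augIdealP p := by
  intro hz
  refine hy (map_le_augIdealP_of_moduleFinite_quotient _ hfin φ (fun x hx => ?_) y)
  obtain ⟨a, rfl⟩ := Submodule.mem_span_singleton.mp hx
  rw [map_smul, smul_eq_mul]
  exact Ideal.mul_mem_left _ a hz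

/-- **Over a domain, a non-zero linear functional on a torsion-free module of rank `≤ 1` is injective**: for `m ∈ ker φ` and `x` with
`φ x ≠ 0`, a dependence `a • x + b • m = 0` (rank `≤ 1`) gives `a · φ x = 0`, so `a = 0`, `b ≠ 0`, `b • m = 0`, `m = 0`.
[cite: Kato2004Asterisque, Thm. 12.4 (2) (p. 221) (where the rank bound comes from)] -/
theorem injective_of_rank_le_one_of_apply_ne_zero {R : Type*} [CommRing R] [IsDomain R]
    {M : Type*} [AddCommGroup M] [Module R M] [NoZeroSMulDivisors R M]
    (hrk : Module.rank R M ≤ 1) (φ : M →ₗ[R] R) {x : M} (hx : φ x ≠ 0) :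
    Function.Injective φ := by
  rw [← LinearMap.ker_eq_bot, Submodule.eq_bot_iff]
  intro m hm
  rw [LinearMap.mem_ker] at hm
  -- `x`, `m` are linearly dependent (`rank ≤ 1`)
  have hdep : ∃ a b : R, (a ≠ 0 ∨ b ≠ 0) ∧ a • x + b • m = 0 := by
    by_contra hcon
    push Not at hcon
    have hli : LinearIndependent R ![x, m] := by
      rw [LinearIndependent.pair_iff]
      intro s t hst
      by_contra hne
      exact hcon s t (not_and_or.mp hne) hst
    have h2 : (2 : Cardinal) ≤ Module.rank R M := by
      simpa using hli.cardinal_lift_le_rank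
    have h21 : (2 : Cardinal) ≤ 1 := h2.trans hrk
    norm_num at h21
  obtain ⟨a, b, hab, h0⟩ := hdep
  have ha : a = 0 := by
    have := congr_arg φ h0
    rw [map_add, map_smul, map_smul, hm, smul_zero, add_zero, map_zero, smul_eq_mul] at this
    exact (mul_eq_zero.mp this).resolve_right hx
  rw [ha, zero_smul, zero_add] at h0
  exact (smul_eq_zero.mp h0).resolve_left (hab.resolve_left (not_not.mpr ha))

/-- **`Λ ⧸ (a)` is finitely generated over `ℤ_p` for `a ∉ (p)`** (`μ(a) = 0`): `a ≠ 0` has non-zero reduction mod `p`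
(`IwasawaAlgebra.map_residue_eq_zero_iff`), so by the Weierstrass preparation theorem `a = g · u` with `g` distinguished and `u ∈ Λˣ`
(Mathlib `PowerSeries.exists_isWeierstrassFactorization`), `(a) = (g)`, and `Λ ⧸ (g) ≅ ℤ_p^{deg g}` (`IwasawaAlgebra.finite_quotient_pow`).
[cite: Washington1997, §7.1 Thm. 7.3 and Prop. 7.2] -/
theorem moduleFinite_quotient_span_singleton_of_notMem_augIdealP {a : IwasawaAlgebra p}
    (ha : a ∉ IwasawaAlgebra.augIdealP p) :
    Module.Finite ℤ_[p] (IwasawaAlgebra p ⧸ Ideal.span {a}) := by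
  have ha' : a.map (IsLocalRing.residue ℤ_[p]) ≠ 0 := fun h =>
    ha ((IwasawaAlgebra.map_residue_eq_zero_iff p a).mp h)
  obtain ⟨g, u, H⟩ := PowerSeries.exists_isWeierstrassFactorization ha'
  have hspan : Ideal.span {a} = Ideal.span {((g : IwasawaAlgebra p)) ^ 1} := by
    rw [pow_one, H.eq_mul, Ideal.span_singleton_mul_right_unit H.isUnit]
  rw [hspan]
  exact finite_quotient_pow p H.isDistinguishedAt 1

/-- **Converse of the cyclic lemma over a torsion-free module of rank `≤ 1`: a `μ`-free value at `z` forces `μ(M ⧸ Λz) = 0`.**  If `M` is a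
torsion-free `Λ`-module of rank `≤ 1` and `φ : M → Λ` is `Λ`-linear with `φ z ∉ (p)`, then `φ` is injective
(`injective_of_rank_le_one_of_apply_ne_zero`), `φ⁻¹(Λ·φ z) = Λz`, so `M ⧸ Λz ↪ Λ ⧸ (φ z)`, which is finitely generated over the Noetherian
ring `ℤ_p` (`moduleFinite_quotient_span_singleton_of_notMem_augIdealP`). [cite: Washington1997, §7.1 Thm. 7.3, §13.2]
[cite: Kato2004Asterisque, Thm. 12.4 (2) (p. 221), §17.13 (p. 280) (shape)] -/
theorem moduleFinite_quotient_span_of_notMem_augIdealP {M : Type*} [AddCommGroup M] [Module (IwasawaAlgebra p) M]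
    [NoZeroSMulDivisors (IwasawaAlgebra p) M] (hrk : Module.rank (IwasawaAlgebra p) M ≤ 1)
    (φ : M →ₗ[IwasawaAlgebra p] IwasawaAlgebra p) (z : M) (hz : φ z ∉ IwasawaAlgebra.augIdealP p) :
    Module.Finite ℤ_[p] (RestrictScalars ℤ_[p] (IwasawaAlgebra p) (M ⧸ (IwasawaAlgebra p) ∙ z)) := by
  letI : Module ℤ_[p] M := Module.compHom M (algebraMap ℤ_[p] (IwasawaAlgebra p))
  haveI : IsScalarTower ℤ_[p] (IwasawaAlgebra p) M := IsScalarTower.of_compHom ℤ_[p] _ M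
  have hz0 : φ z ≠ 0 := fun h => hz (by rw [h]; exact Ideal.zero_mem _)
  have hinj : Function.Injective φ := injective_of_rank_le_one_of_apply_ne_zero hrk φ hz0
  -- the induced map `M ⧸ Λz → Λ ⧸ (φ z)`
  let ψ : M →ₗ[IwasawaAlgebra p] IwasawaAlgebra p ⧸ Ideal.span {φ z} :=
    (Submodule.mkQ (Ideal.span {φ z})).comp φ
  have hle : (IwasawaAlgebra p) ∙ z ≤ LinearMap.ker ψ := by
    rw [Submodule.span_singleton_le_iff_mem, LinearMap.mem_ker]
    change Submodule.mkQ (Ideal.span {φ z}) (φ z) = 0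
    rw [Submodule.mkQ_apply, Submodule.Quotient.mk_eq_zero]
    exact Ideal.mem_span_singleton_self _
  have hker : LinearMap.ker ψ ≤ (IwasawaAlgebra p) ∙ z := by
    intro m hm
    rw [LinearMap.mem_ker] at hm
    change Submodule.mkQ (Ideal.span {φ z}) (φ m) = 0 at hm
    rw [Submodule.mkQ_apply, Submodule.Quotient.mk_eq_zero, Ideal.mem_span_singleton'] at hm
    obtain ⟨b, hb⟩ := hm
    have hm' : m = b • z := hinj (by rw [map_smul, smul_eq_mul, hb])
    exact Submodule.mem_span_singleton.mpr ⟨b, hm'.symm⟩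
  have hψinj : Function.Injective (((IwasawaAlgebra p) ∙ z).liftQ ψ hle) := by
    rw [← LinearMap.ker_eq_bot]
    exact Submodule.ker_liftQ_eq_bot _ _ _ hker
  haveI : Module.Finite ℤ_[p] (IwasawaAlgebra p ⧸ Ideal.span {φ z}) :=
    moduleFinite_quotient_span_singleton_of_notMem_augIdealP hz
  haveI : IsNoetherian ℤ_[p] (IwasawaAlgebra p ⧸ Ideal.span {φ z}) :=
    isNoetherian_of_isNoetherianRing_of_finite ℤ_[p] _
  change Module.Finite ℤ_[p] (M ⧸ (IwasawaAlgebra p) ∙ z)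
  exact Module.Finite.of_injective ((((IwasawaAlgebra p) ∙ z).liftQ ψ hle).restrictScalars ℤ_[p]) hψinj

end Algebra

/-! ## §2 On Kato's carriers (every `p`) -/

section Carriers

variable {p : ℕ} [Fact p.Prime]

/-- **`μ(X) = 0` ∧ `μ(𝐇¹_Γ/Λz) = 0` ⟹ every NORMALISED ordinary-kernel functional is `μ`-free at `loc_v z`** (every `p`, on Kato's
pinned carriers).  From the Poitou–Tate exactness fact p729889 (clauses (C)(E)) and `X = D.X` finitely generated over `ℤ_p` (for torsion `X`:
Greenberg's Conjecture 1.11 — a HYPOTHESIS) g6's `exists_notMem_col_loc_of_poitouTate_of_moduleFinite` gives SOME `y ∈ 𝐇¹_Γ(T_pW)` with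
`col(loc_v y) ∉ (p)` for every `Λ`-linear `col : 𝐇¹_{loc,Γ} → Λ` killing `range(J′ → J)` with a value outside `(p)`; if moreover
`𝐇¹_Γ ⧸ Λz` is finitely generated over `ℤ_p` (a HYPOTHESIS: the `μ`-part of Kato's term `𝐇¹(T)/Z(f,T)` when `z` is the zeta class), then
`col(loc_v z) ∉ (p)` (§1, with `φ = col ∘ loc_v`). CONDITIONAL; nothing about any curve is asserted.
[cite: Kato2004Asterisque, §17.13 (17.13.1)–(17.13.3) (pp. 279–280)] [cite: GreenbergLNM1716, Conj. 1.11 (p. 64), §4 p. 122] [cite: MilneADT2006, I Thm. 4.10] -/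
theorem notMem_col_loc_of_poitouTate_of_moduleFinite_quotient_span (hPT : exists_lambdaAdicLocalTatePairing_poitouTate_exact)
    (W : WeierstrassCurve ℚ) [W.IsElliptic] [W.IsGloballyMinimal]
    [ContinuousSMul ℤ_[p] (W.tateModule p)] [Module.Free ℤ_[p] (W.tateModule p)] [Module.Finite ℤ_[p] (W.tateModule p)]
    (κ : ZpExtension ℚ p) (γ : absoluteGaloisGroup ℚ) (hκ : κ.IsCyclotomic) (hγ : κ.IsTopGenerator γ) (hord : IsOrdinaryAt W p)
    (v : HeightOneSpectrum (𝓞 ℚ)) (hv : ((p : ℕ) : 𝓞 ℚ) ∈ v.asIdeal) (γᵥ : absoluteGaloisGroup (v.adicCompletion ℚ))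
    (hsurj : Function.Surjective
      (κ.toContinuousMonoidHom.comp (resGalOfEmb (closureEmb (K := ℚ) (v.adicCompletion ℚ)))))
    (hγᵥ : κ.IsTopGenerator (resGalOfEmb (closureEmb (K := ℚ) (v.adicCompletion ℚ)) γᵥ))
    (I : IwasawaH1Data W p κ γ) (J : LocalIwasawaH1Data κ v ((tateRep W p).toLocal v) γᵥ)
    (J' : LocalIwasawaH1Data κ v (tateLocalOrdinaryRep W p v) γᵥ)
    (D : W.SelmerDualData κ γ) (hfin : Module.Finite ℤ_[p] (RestrictScalars ℤ_[p] (IwasawaAlgebra p) D.X))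
    (z : I.H) (hz : Module.Finite ℤ_[p] (RestrictScalars ℤ_[p] (IwasawaAlgebra p) (I.H ⧸ (IwasawaAlgebra p) ∙ z)))
    (col : J.H →ₗ[IwasawaAlgebra p] IwasawaAlgebra p)
    (hker : ∀ y : J'.H, col (J'.ordinaryInclusion J y) = 0) (hnorm : ∃ x : J.H, col x ∉ IwasawaAlgebra.augIdealP p) :
    col (I.loc J hsurj hγ hγᵥ z) ∉ IwasawaAlgebra.augIdealP p := by
  obtain ⟨y, hy⟩ := exists_notMem_col_loc_of_poitouTate_of_moduleFinite hPT W κ γ hκ hγ hord v hv γᵥ hsurj hγᵥ I J J' D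
    hfin col hker hnorm
  exact notMem_augIdealP_of_moduleFinite_quotient_span z hz (col.comp (I.loc J hsurj hγ hγᵥ)) (y := y) hy

/-- **Converse on the carriers: ONE `μ`-free value at `loc_v z` ⟹ `μ(𝐇¹_Γ/Λz) = 0`, granted `rank_Λ 𝐇¹_Γ(T_pW) ≤ 1`** (Kato Thm. 12.4 (2),
the HYPOTHESIS `hrk` — supplied by the named fact `thm12_4` or by `IwasawaH1Data.rank_le_one_of_rank_integralH1_le_one`; torsion-freeness of
`𝐇¹_Γ` is the tree theorem `IwasawaH1Data.isTorsionFree`): `φ = col ∘ loc_v` is then injective on `𝐇¹_Γ` and `𝐇¹_Γ ⧸ Λz ↪ Λ ⧸ (φ z)`,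
finitely generated over `ℤ_p` (§1). [cite: Kato2004Asterisque, Thm. 12.4 (2) (p. 221), §17.13 (p. 280)] [cite: Washington1997, §7.1 Thm. 7.3] -/
theorem moduleFinite_iwasawaH1_quotient_span_of_notMem_col_loc
    (W : WeierstrassCurve ℚ) [W.IsElliptic] [ContinuousSMul ℤ_[p] (W.tateModule p)]
    (κ : ZpExtension ℚ p) (γ : absoluteGaloisGroup ℚ) (hγ : κ.IsTopGenerator γ)
    (v : HeightOneSpectrum (𝓞 ℚ)) (γᵥ : absoluteGaloisGroup (v.adicCompletion ℚ))
    (hsurj : Function.Surjective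
      (κ.toContinuousMonoidHom.comp (resGalOfEmb (closureEmb (K := ℚ) (v.adicCompletion ℚ)))))
    (hγᵥ : κ.IsTopGenerator (resGalOfEmb (closureEmb (K := ℚ) (v.adicCompletion ℚ)) γᵥ))
    (I : IwasawaH1Data W p κ γ) (hrk : Module.rank (IwasawaAlgebra p) I.H ≤ 1)
    (J : LocalIwasawaH1Data κ v ((tateRep W p).toLocal v) γᵥ)
    (col : J.H →ₗ[IwasawaAlgebra p] IwasawaAlgebra p) (z : I.H)
    (hz : col (I.loc J hsurj hγ hγᵥ z) ∉ IwasawaAlgebra.augIdealP p) :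
    Module.Finite ℤ_[p] (RestrictScalars ℤ_[p] (IwasawaAlgebra p) (I.H ⧸ (IwasawaAlgebra p) ∙ z)) := by
  haveI := I.noZeroSMulDivisors hγ
  exact moduleFinite_quotient_span_of_notMem_augIdealP hrk (col.comp (I.loc J hsurj hγ hγᵥ)) z hz

/-- The same with the rank bound taken from the named fact `thm12_4` (Kato Thm. 12.4 (2): `rank_Λ 𝐇¹_Γ(T_pW) = 1`, every `p`).
[cite: Kato2004Asterisque, Thm. 12.4 (2) (p. 221), §17.13 (p. 280)] -/
theorem moduleFinite_iwasawaH1_quotient_span_of_notMem_col_loc_of_thm12_4 (h12 : thm12_4)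
    (W : WeierstrassCurve ℚ) [W.IsElliptic] [ContinuousSMul ℤ_[p] (W.tateModule p)]
    (κ : ZpExtension ℚ p) (γ : absoluteGaloisGroup ℚ) (hκ : κ.IsCyclotomic) (hγ : κ.IsTopGenerator γ)
    (v : HeightOneSpectrum (𝓞 ℚ)) (γᵥ : absoluteGaloisGroup (v.adicCompletion ℚ))
    (hsurj : Function.Surjective
      (κ.toContinuousMonoidHom.comp (resGalOfEmb (closureEmb (K := ℚ) (v.adicCompletion ℚ)))))
    (hγᵥ : κ.IsTopGenerator (resGalOfEmb (closureEmb (K := ℚ) (v.adicCompletion ℚ)) γᵥ))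
    (I : IwasawaH1Data W p κ γ) (J : LocalIwasawaH1Data κ v ((tateRep W p).toLocal v) γᵥ)
    (col : J.H →ₗ[IwasawaAlgebra p] IwasawaAlgebra p) (z : I.H)
    (hz : col (I.loc J hsurj hγ hγᵥ z) ∉ IwasawaAlgebra.augIdealP p) :
    Module.Finite ℤ_[p] (RestrictScalars ℤ_[p] (IwasawaAlgebra p) (I.H ⧸ (IwasawaAlgebra p) ∙ z)) :=
  moduleFinite_iwasawaH1_quotient_span_of_notMem_col_loc W κ γ hγ v γᵥ hsurj hγᵥ I
    (h12.isTorsionFree_and_rank_le_one W p hκ hγ I).2 J col z hz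

end Carriers

/-! ## §3 (appended) `μ(M ⧸ Λz) = 0` forbids `z ∈ p·M`: the zeta quotient detects `p`-divisibility of the class -/

section Divisibility

variable {p : ℕ} [Fact p.Prime]

/-- **A class divisible by `p` in a non-zero torsion-free `Λ`-module has a quotient of positive `μ`**: if `M` has no zero-divisors, `M ≠ 0`
and `z ∈ (p)·M`, then `M ⧸ Λz` is NOT finitely generated over `ℤ_p`. Indeed write `z = p • w`; for `e := w` (or any `e ≠ 0` if `w = 0`) an
`X`-monic relation `g • ē = 0` in `M ⧸ Λz` (g6's `exists_monic_smul_eq_zero_of_moduleFinite`) reads `g • e = a • (p • w)`, whence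
`(g − a·p) • e = 0` (resp. `g • e = 0`), so `g ∈ (p)` (resp. `g = 0`) — but an `X`-monic `g` is not in `(p)` (`X_pow_sub_sum_notMem_augIdealP`).
The `μ`-bookkeeping behind «every genuine class `p`-divisible ⟹ `μ(𝐇¹/Λz) ≥ 1`». [cite: Washington1997, §13.2]
[cite: Kato2004Asterisque, Thm. 12.4 (2) (p. 221), §17.13 (p. 280) (shape)] -/
theorem not_moduleFinite_quotient_span_of_mem_augIdealP_smul_top {M : Type*} [AddCommGroup M] [Module (IwasawaAlgebra p) M]
    [NoZeroSMulDivisors (IwasawaAlgebra p) M] [Nontrivial M] {z : M}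
    (hz : z ∈ IwasawaAlgebra.augIdealP p • (⊤ : Submodule (IwasawaAlgebra p) M)) :
    ¬ Module.Finite ℤ_[p] (RestrictScalars ℤ_[p] (IwasawaAlgebra p) (M ⧸ (IwasawaAlgebra p) ∙ z)) := by
  intro hfin
  rw [IwasawaAlgebra.augIdealP, Submodule.ideal_span_singleton_smul, Submodule.mem_smul_pointwise_iff_exists] at hz
  obtain ⟨w, -, rfl⟩ := hz
  -- an element `e ≠ 0` with `Λ e ∩ Λ(p w)` controlled: `e = w` if `w ≠ 0`, else any non-zero `e`
  obtain ⟨e, he0, hew⟩ : ∃ e : M, e ≠ 0 ∧ (w = 0 ∨ e = w) := by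
    by_cases hw : w = 0
    · obtain ⟨e, he⟩ := exists_ne (0 : M)
      exact ⟨e, he, Or.inl hw⟩
    · exact ⟨w, hw, Or.inr rfl⟩
  obtain ⟨n, c, hg⟩ := exists_monic_smul_eq_zero_of_moduleFinite hfin (Submodule.Quotient.mk e)
  set g : IwasawaAlgebra p := (PowerSeries.X : IwasawaAlgebra p) ^ n - ∑ i : Fin n, PowerSeries.C (c i) * PowerSeries.X ^ (i : ℕ)
    with hg_def
  have hgp : g ∉ IwasawaAlgebra.augIdealP p := X_pow_sub_sum_notMem_augIdealP n c
  rw [← Submodule.Quotient.mk_smul, Submodule.Quotient.mk_eq_zero, Submodule.mem_span_singleton] at hg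
  obtain ⟨a, ha⟩ := hg
  rcases hew with hw | rfl
  · -- `w = 0`: `g • e = a • (p • 0) = 0`, so `g = 0 ∈ (p)`
    rw [hw, smul_zero, smul_zero] at ha
    rcases smul_eq_zero.mp ha.symm with h0 | h0
    · exact hgp (h0 ▸ Ideal.zero_mem _)
    · exact he0 h0
  · -- `e = w ≠ 0`: `(g − a·p) • w = 0`, so `g = a·p ∈ (p)`
    have h0 : (g - a * PowerSeries.C (p : ℤ_[p])) • e = 0 := by
      rw [sub_smul, mul_smul, ha, sub_self]
    rcases smul_eq_zero.mp h0 with h1 | h1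
    · exact hgp (by
        rw [sub_eq_zero] at h1
        rw [h1, IwasawaAlgebra.augIdealP]
        exact Ideal.mul_mem_left _ a (Ideal.mem_span_singleton_self _))
    · exact he0 h1

/-- **On Kato's carriers: a class `z ∈ 𝐇¹_Γ(T_pW)` with `μ(𝐇¹_Γ/Λz) = 0` is NOT divisible by `p` in `𝐇¹_Γ`** (`z ∉ (p)·𝐇¹_Γ`), granted
`𝐇¹_Γ ≠ 0` (the HYPOTHESIS `Nontrivial I.H` — the lower half of Kato Thm. 12.4 (2), `nontrivial_iwasawaH1_of_thm12_4`); torsion-freeness is the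
tree theorem `IwasawaH1Data.noZeroSMulDivisors`. The currency `augIdealP p • ⊤` is that of the Summits-side Negative lemma
`…OrdKatoHalfAtTwoIso/Negative/ZetaColemanMuTwoDivisible` (p691215). [cite: Kato2004Asterisque, Thm. 12.4 (2) (p. 221), §17.13 (p. 280) (shape)] -/
theorem IwasawaH1Data.not_mem_augIdealP_smul_top_of_moduleFinite_quotient_span
    {W : WeierstrassCurve ℚ} [W.IsElliptic] [ContinuousSMul ℤ_[p] (W.tateModule p)]
    {κ : ZpExtension ℚ p} {γ : absoluteGaloisGroup ℚ} (hγ : κ.IsTopGenerator γ) (I : IwasawaH1Data W p κ γ)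
    [Nontrivial I.H] {z : I.H}
    (hz : Module.Finite ℤ_[p] (RestrictScalars ℤ_[p] (IwasawaAlgebra p) (I.H ⧸ (IwasawaAlgebra p) ∙ z))) :
    z ∉ IwasawaAlgebra.augIdealP p • (⊤ : Submodule (IwasawaAlgebra p) I.H) := by
  haveI := I.noZeroSMulDivisors hγ
  exact fun hmem => not_moduleFinite_quotient_span_of_mem_augIdealP_smul_top hmem hz

/-- The same with `𝐇¹_Γ ≠ 0` taken from the named fact `thm12_4` (Kato Thm. 12.4 (2): `rank_Λ 𝐇¹_Γ(T_pW) = 1`, every `p`).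
[cite: Kato2004Asterisque, Thm. 12.4 (2) (p. 221)] -/
theorem IwasawaH1Data.not_mem_augIdealP_smul_top_of_moduleFinite_quotient_span_of_thm12_4 (h12 : thm12_4)
    {W : WeierstrassCurve ℚ} [W.IsElliptic] [ContinuousSMul ℤ_[p] (W.tateModule p)]
    {κ : ZpExtension ℚ p} {γ : absoluteGaloisGroup ℚ} (hκ : κ.IsCyclotomic) (hγ : κ.IsTopGenerator γ)
    (I : IwasawaH1Data W p κ γ) {z : I.H}
    (hz : Module.Finite ℤ_[p] (RestrictScalars ℤ_[p] (IwasawaAlgebra p) (I.H ⧸ (IwasawaAlgebra p) ∙ z))) :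
    z ∉ IwasawaAlgebra.augIdealP p • (⊤ : Submodule (IwasawaAlgebra p) I.H) := by
  haveI : Nontrivial I.H := nontrivial_iwasawaH1_of_thm12_4 h12 W p κ γ hκ hγ I
  exact I.not_mem_augIdealP_smul_top_of_moduleFinite_quotient_span hγ hz

end Divisibility

end Literature.NumberTheory.EllipticCurves.Kato2004

end
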